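import Literature.Algebra.EuclideanLattices.GaussianCosetSmoothing
import Literature.Algebra.EuclideanLattices.SmoothingParameterGramSchmidt
import HarnessLib

/-!
# The discrete Gaussian over the integers `D_{ℤ,s,c}`

Topic `Algebra/EuclideanLattices` (family `pqc`). The one-dimensional discrete Gaussian
`D_{ℤ,s,c}(k) ∝ ρ_s(k - c) = exp(-π(k - c)²/s²)` on `ℤ` with real centre `c` is the sampling primitive
of the Gentry–Peikert–Vaikuntanathan sampler (STOC 2008, §4.1 "SampleZ", §4.2 "SampleD": the
randomised nearest-plane algorithm draws its `i`-th coefficient from `D_{ℤ, s/‖b̃ᵢ‖, cᵢ}`), whose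
analysis (Thm. 4.1) rests on ONE fact about it: above the smoothing parameter of `ℤ` the normalising
sum `ρ_{s,c}(ℤ)` does not depend on the centre up to a factor `(1-ε)/(1+ε)`. This file instantiates
the tree's lattice Gaussian library (`discreteGaussian`, `smoothingParameter`, GPV Lemma 3.1
`smoothingParameter_le_norm_gramSchmidt_mul`, BLPRS Lemma 2.7 `ofReal_mul_gaussianMass_lattice_le_and_le`)
at the lattice `ℤ ⊂ ℝ` and transports the results to the type `ℤ`. Everything is PROVED; no named
fact. It is the first brick of the second component (Prop. 2.8 = GPV Thm. 4.1) of Peikert's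
classical `GapSVP → LWE` reduction (`Literature.Computability.Cryptography.PeikertReduction`, pqc.S20).

## Results

* `intLattice : Submodule ℤ ℝ` — `ℤ` as the `ℤ`-span of the basis `{1}` of `ℝ` (so Mathlib's `ZSpan`
  instances apply: `instDiscreteTopologyIntLattice`, `instIsZLatticeIntLattice`); `mem_intLattice_iff`;
  the bijections `intLatticeEquiv : ℤ ≃ intLattice`, `intLatticeAddEquiv : ℤ ≃+ intLattice`; the
  `ℤ`-basis `intLatticeBasis` (`= {1}`, `coe_intLatticeBasis`).
* **`smoothingParameter_intLattice_le`**: `η_ε(ℤ) ≤ √(ln(2(1+1/ε))/π)` (GPV Lemma 3.1 with `n = 1`,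
  `‖B̃‖ = 1`).
* `gaussianMassInt s c = ∑_{k ∈ ℤ} ρ_s(k - c)` (`= gaussianMass s c intLattice`,
  `gaussianMass_intLattice`; nonzero, finite for `s ≠ 0`); **`discreteGaussianInt s c : PMF ℤ`** with the
  mass formula `discreteGaussianInt_apply` (`D_{ℤ,s,c}(k) = ρ_s(k - c) · ρ_{s,c}(ℤ)⁻¹`, `0 < s`) and
  full support `discreteGaussianInt_pos`.
* **`gaussianMassInt_le_and_le`** (`η_ε(ℤ) ≤ s`) and **`gaussianMassInt_le_and_le_of_sqrt_log_le`**
  (`s ≥ √(ln(2(1+1/ε))/π)`): `(1-ε)/(1+ε) · ρ_s(ℤ) ≤ ρ_{s,c}(ℤ) ≤ ρ_s(ℤ)` for every centre `c`.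

## Design

* `ℝ` is used as the ambient inner product space (not `EuclideanSpace ℝ (Fin 1)`), so that centres
  and samples are plain reals/integers, as in GPV §4.1.
* The junk value of `discreteGaussianInt s c` for `s ≤ 0` (point mass at `0`) is inherited from
  `discreteGaussian`; all statements assume `0 < s`.
* NOT here: samplers/algorithms for `D_{ℤ,s,c}` (GPV §4.1 rejection sampling), tail bounds
  (Banaszczyk, available for any lattice in `GaussianLatticeTails.lean`), the nearest-plane product
  `D_{ℤⁿ}`-form of the GPV output (sequel).

## References

* C. Gentry, C. Peikert, V. Vaikuntanathan, *Trapdoors for hard lattices and new cryptographic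
  constructions*, STOC 2008, Lemma 3.1, §4.1–4.2, Thm. 4.1 [GentryPeikertVaikuntanathan2008].
* Z. Brakerski, A. Langlois, C. Peikert, O. Regev, D. Stehlé, *Classical hardness of learning with
  errors*, STOC 2013, Lemmas 2.5, 2.7 [BrakerskiEtAl2013].
* D. Micciancio, O. Regev, *Worst-case to average-case reductions based on Gaussian measures*,
  SIAM J. Comput. 37 (2007), §2 [MicciancioRegev2007].
-/

noncomputable section

open _root_.MeasureTheory Real
open scoped ENNReal

namespace Literature.Algebra.EuclideanLattices

/-! ### The integers as a lattice in the real line -/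

/-- The integers `ℤ ⊂ ℝ` as a lattice in the one-dimensional inner product space `ℝ`: the `ℤ`-span of
the basis `{1}` (`Basis.singleton`), so that Mathlib's `ZSpan` instances (`DiscreteTopology`,
`IsZLattice`) and the tree's lattice Gaussian library (`discreteGaussian`, `smoothingParameter`, …)
apply to it. [folklore] -/
def intLattice : Submodule ℤ ℝ :=
  Submodule.span ℤ (Set.range (Module.Basis.singleton (Fin 1) ℝ))

/-- `ℤ ⊂ ℝ` is discrete (a `ZSpan`). [folklore] -/
instance instDiscreteTopologyIntLattice : DiscreteTopology intLattice :=
  inferInstanceAs (DiscreteTopology (Submodule.span ℤ (Set.range (Module.Basis.singleton (Fin 1) ℝ))))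

/-- `ℤ ⊂ ℝ` is a full lattice (a `ZSpan`). [folklore] -/
instance instIsZLatticeIntLattice : IsZLattice ℝ intLattice :=
  inferInstanceAs (IsZLattice ℝ (Submodule.span ℤ (Set.range (Module.Basis.singleton (Fin 1) ℝ))))

/-- Membership: a real number lies in `intLattice` iff it is an integer. [folklore] -/
theorem mem_intLattice_iff (x : ℝ) : x ∈ intLattice ↔ ∃ k : ℤ, (k : ℝ) = x := by
  rw [intLattice, Module.Basis.mem_span_iff_repr_mem]
  simp only [Module.Basis.singleton_repr, Set.mem_range, eq_intCast]
  exact ⟨fun h => h 0, fun h _ => h⟩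

/-- Integers lie in `intLattice`. [folklore] -/
theorem intCast_mem_intLattice (k : ℤ) : (k : ℝ) ∈ intLattice :=
  (mem_intLattice_iff _).2 ⟨k, rfl⟩

/-- The bijection `ℤ ≃ intLattice`, `k ↦ (k : ℝ)` (inverse: the floor). [folklore] -/
def intLatticeEquiv : ℤ ≃ intLattice where
  toFun k := ⟨k, intCast_mem_intLattice k⟩
  invFun x := ⌊(x : ℝ)⌋
  left_inv k := Int.floor_intCast k
  right_inv x := by
    obtain ⟨k, hk⟩ := (mem_intLattice_iff (x : ℝ)).1 x.2
    apply Subtype.ext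
    simp only [← hk, Int.floor_intCast]

/-- `intLatticeEquiv k = k` in `ℝ`. [folklore] -/
@[simp] theorem coe_intLatticeEquiv (k : ℤ) : ((intLatticeEquiv k : intLattice) : ℝ) = k := rfl

/-- The bijection `ℤ ≃ intLattice` is additive. [folklore] -/
def intLatticeAddEquiv : ℤ ≃+ intLattice :=
  { intLatticeEquiv with
    map_add' := fun a b => Subtype.ext (by
      change ((a + b : ℤ) : ℝ) = (a : ℝ) + (b : ℝ)
      exact Int.cast_add a b) }

/-- `intLatticeAddEquiv k = k` in `ℝ`. [folklore] -/
@[simp] theorem coe_intLatticeAddEquiv (k : ℤ) : ((intLatticeAddEquiv k : intLattice) : ℝ) = k := rfl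

/-- The `ℤ`-basis `{1}` of `intLattice` (the image of the basis `{1}` of `ℤ`). [folklore] -/
def intLatticeBasis : Module.Basis (Fin 1) ℤ intLattice :=
  (Module.Basis.singleton (Fin 1) ℤ).map intLatticeAddEquiv.toIntLinearEquiv

/-- The basis vector of `intLattice` is `1`. [folklore] -/
@[simp] theorem coe_intLatticeBasis (i : Fin 1) : ((intLatticeBasis i : intLattice) : ℝ) = 1 := by
  rw [intLatticeBasis, Module.Basis.map_apply, Module.Basis.singleton_apply]
  change ((intLatticeAddEquiv 1 : intLattice) : ℝ) = 1
  rw [coe_intLatticeAddEquiv, Int.cast_one]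

/-! ### The smoothing parameter of `ℤ` -/

/-- **`η_ε(ℤ) ≤ √(ln(2(1+1/ε))/π)`** for every `ε > 0`: Gentry–Peikert–Vaikuntanathan 2008,
Lemma 3.1 (`η_ε(L) ≤ ‖B̃‖·√(ln(2n(1+1/ε))/π)`, the tree's `smoothingParameter_le_norm_gramSchmidt_mul`)
for the basis `{1}` of `ℤ` (`n = 1`, `‖B̃‖ = 1`); the special case `ε = negl` is the `ω(√(log n))`
bound on `η_ε(ℤ)` used by the GPV sampler (GPV 2008, §4). [cite: GentryPeikertVaikuntanathan2008, Lemma 3.1] -/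
theorem smoothingParameter_intLattice_le {ε : ℝ} (hε : 0 < ε) :
    smoothingParameter intLattice ε ≤ Real.sqrt (Real.log (2 * (1 + 1 / ε)) / π) := by
  have hGS : ∀ i : Fin 1,
      ‖InnerProductSpace.gramSchmidt ℝ (fun j => ((intLatticeBasis j : intLattice) : ℝ)) i‖ ≤ 1 := by
    intro i
    have hi : i = ⊥ := Subsingleton.elim _ _
    subst hi
    rw [InnerProductSpace.gramSchmidt_bot]
    simp
  have h := smoothingParameter_le_norm_gramSchmidt_mul intLattice intLatticeBasis hε hGS
  simpa using h

/-! ### Gaussian sums over `ℤ` and the discrete Gaussian `D_{ℤ,s,c}` -/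

/-- The Gaussian mass `ρ_{s,c}(ℤ) = ∑_{k ∈ ℤ} ρ_s(k - c) ∈ [0, ∞]` of the integers
(`ρ_s(x) = exp(-π x²/s²)`). [cite: MicciancioRegev2007, §2] -/
def gaussianMassInt (s c : ℝ) : ℝ≥0∞ :=
  ∑' k : ℤ, ENNReal.ofReal (gaussianFunction s ((k : ℝ) - c))

/-- `ρ_{s,c}(ℤ)` is the lattice library's `gaussianMass s c intLattice`. [folklore] -/
theorem gaussianMass_intLattice (s c : ℝ) :
    gaussianMass s c (intLattice : Set ℝ) = gaussianMassInt s c := by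
  rw [gaussianMass, gaussianMassInt]
  exact (Equiv.tsum_eq intLatticeEquiv
    (fun x : (intLattice : Set ℝ) => ENNReal.ofReal (gaussianFunction s ((x : ℝ) - c)))).symm

/-- `ρ_{s,c}(ℤ) ≠ 0`. [folklore] -/
theorem gaussianMassInt_ne_zero (s c : ℝ) : gaussianMassInt s c ≠ 0 := by
  rw [← gaussianMass_intLattice]; exact gaussianMass_lattice_ne_zero intLattice s c

/-- `ρ_{s,c}(ℤ) < ∞` for `s ≠ 0`. [folklore] -/
theorem gaussianMassInt_ne_top {s : ℝ} (hs : s ≠ 0) (c : ℝ) : gaussianMassInt s c ≠ ∞ := by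
  rw [← gaussianMass_intLattice]; exact gaussianMass_lattice_ne_top intLattice hs c

/-- **The discrete Gaussian over the integers** `D_{ℤ,s,c}`: the probability mass function on `ℤ`
with `D_{ℤ,s,c}(k) = ρ_s(k - c)/ρ_{s,c}(ℤ)` — the one-dimensional sampling primitive of the GPV
sampler ("SampleZ", Gentry–Peikert–Vaikuntanathan 2008, §4.1) —, realised as the tree's
`discreteGaussian intLattice s c` transported to `ℤ`. Junk value for `s ≤ 0`: the point mass at `0`
(inherited). [cite: GentryPeikertVaikuntanathan2008, §4.1] -/
def discreteGaussianInt (s c : ℝ) : PMF ℤ :=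
  (discreteGaussian intLattice s c).map intLatticeEquiv.symm

/-- **Mass formula**: `D_{ℤ,s,c}(k) = ρ_s(k - c) · ρ_{s,c}(ℤ)⁻¹` for `0 < s`. [cite: GentryPeikertVaikuntanathan2008, §4.1] -/
theorem discreteGaussianInt_apply {s : ℝ} (hs : 0 < s) (c : ℝ) (k : ℤ) :
    discreteGaussianInt s c k =
      ENNReal.ofReal (gaussianFunction s ((k : ℝ) - c)) * (gaussianMassInt s c)⁻¹ := by
  rw [discreteGaussianInt, PMF.map_apply, tsum_eq_single (intLatticeEquiv k)]
  · rw [if_pos (intLatticeEquiv.symm_apply_apply k).symm, discreteGaussian_apply intLattice hs,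
      gaussianMass_intLattice]
    rfl
  · intro x hx
    rw [if_neg]
    intro h
    exact hx (by rw [h, Equiv.apply_symm_apply])

/-- Every integer has positive probability under `D_{ℤ,s,c}` (`0 < s`). [folklore] -/
theorem discreteGaussianInt_pos {s : ℝ} (hs : 0 < s) (c : ℝ) (k : ℤ) : 0 < discreteGaussianInt s c k := by
  rw [discreteGaussianInt_apply hs]
  exact ENNReal.mul_pos (by simpa using gaussianFunction_pos s _)
    (ENNReal.inv_ne_zero.2 (gaussianMassInt_ne_top hs.ne' c))

/-! ### Coset masses above the smoothing parameter -/

/-- **The Gaussian mass of `ℤ - c` above the smoothing parameter** (Regev 2009, Claim 3.8 /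
BLPRS 2013, Lemma 2.7, for the lattice `ℤ`): for `0 < ε`, `0 < s` with `η_ε(ℤ) ≤ s` and every
centre `c`, `(1-ε)/(1+ε) · ρ_s(ℤ) ≤ ρ_{s,c}(ℤ) ≤ ρ_s(ℤ)` — the normalising sums of `D_{ℤ,s,c}` are the
same for all centres up to a factor `(1-ε)/(1+ε)` (the fact behind the GPV sampler's analysis,
GPV 2008, proof of Thm. 4.1). The tree's `ofReal_mul_gaussianMass_lattice_le_and_le` for `intLattice`.
[cite: BrakerskiEtAl2013, Lemma 2.7] -/
theorem gaussianMassInt_le_and_le {ε s : ℝ} (hε : 0 < ε) (hs : 0 < s)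
    (hηs : smoothingParameter intLattice ε ≤ s) (c : ℝ) :
    ENNReal.ofReal ((1 - ε) / (1 + ε)) * gaussianMassInt s 0 ≤ gaussianMassInt s c ∧
      gaussianMassInt s c ≤ gaussianMassInt s 0 := by
  have h := ofReal_mul_gaussianMass_lattice_le_and_le intLattice hε hs hηs c
  rwa [gaussianMass_intLattice, gaussianMass_intLattice] at h

/-- The same bounds under the explicit hypothesis `s ≥ √(ln(2(1+1/ε))/π)` (which dominates `η_ε(ℤ)`,
`smoothingParameter_intLattice_le`). [cite: GentryPeikertVaikuntanathan2008, Lemma 3.1 and proof of Thm. 4.1] -/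
theorem gaussianMassInt_le_and_le_of_sqrt_log_le {ε s : ℝ} (hε : 0 < ε)
    (hs : Real.sqrt (Real.log (2 * (1 + 1 / ε)) / π) ≤ s) (hs0 : 0 < s) (c : ℝ) :
    ENNReal.ofReal ((1 - ε) / (1 + ε)) * gaussianMassInt s 0 ≤ gaussianMassInt s c ∧
      gaussianMassInt s c ≤ gaussianMassInt s 0 :=
  gaussianMassInt_le_and_le hε hs0 ((smoothingParameter_intLattice_le hε).trans hs) c

end Literature.Algebra.EuclideanLattices

end
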